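import Literature.NumberTheory.Rogawski1990.ExplicitFactorProductFormula
import HarnessLib

/-!
# THE PRODUCT FORMULA FOR ROGAWSKI'S EXPLICIT TRANSFER FACTORS AT `(G,H)`-REGULAR RATIONAL PAIRS — PART 1: the `κ`-side without `G`-regularity

Topic `NumberTheory/Rogawski1990`; namespace `Literature.NumberTheory.Rogawski1990`.  THEOREMS ONLY (no definition, no named fact, no instance, no notation,
no `sorry`); imports ★ `ExplicitFactorProductFormula` (p828307) and everything it re-exports.  Cell `pub/hodgecm-mathlib`, F0∕P3a, seat F0P3a-p05 (g9); part 1 of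
the (P-α) brick of the #88 repair census `F0/P3a/F0P3a-p05/g9/SIZING-S1prime.F0P3a-p05g9.md` §2 row (κ-sign) (LEAD DESK WORDS T6-33 (b), T6-35, T6-38 (2));
part 2 = `ExplicitFactorProductFormulaGHRegular.lean` (the three partial products and the product formula).

WHY.  ★ `satisfiesProductFormula_finExplicitCollection` (p828307) proves `(∏ᶠ_v Δ‴_v(γ_H, γ)) · Δ‴_∞(γ_H ⊗ 1, γ ⊗ 1) = 1` on rational matching pairs with
`γ_H = (g, u)` **`G`-regular** (the binder of ★ `SatisfiesProductFormula`).  Print uses the product formula at the SINGULAR semisimple `γ₀ ∈ M` of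
[Rogawski1990, Prop. 8.2.1 (b)] («Part (b) follows from (a) and the product formula `ΠΔ_{G_v∕H_v}(γ_{ov}) = 1` for `γ₀ ∈ M`», p. 117), where
`γ_H = (e₁•1₂, e₂)` is `(G,H)`-regular (`u = e₂` is not an eigenvalue of `g = e₁•1₂`) but NOT `G`-regular.  p828307's proof consumed `G`-regularity ONLY
through `χ_g(u) ≠ 0` and `P = χ_g(γ) ≠ 0`; both hold under
  `hχ : (charpoly g).eval u ≠ 0`                                                                                             — (G,H)-regularity.
This part re-proves the `κ`-side inputs under `hχ` (statements of record untouched; `_of_eval_ne_zero` ∕ primed VARIANTS):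
* §1 private rank-one algebra over `ℂ` (as in ★ `ExplicitFactorProductFormulaParts` §4, where it is `private`).
* §2 `archKappaSignAt_eq_sign_re_embedding_columnFormValue'` — ★ `…Parts` :219 WITHOUT `hreg`, `hanis`, `hherm`: on a matching pair with `P_w = σ_w(P)`,
  `κ‴_w = sgn Re σ_w(x_{j₀})` for any non-zero column `j₀` of `P` (the ★ proof used `IsArchGRegular` only for an auxiliary `vᴴHv ≠ 0` its final computation
  never reads; `P_w = v qᵀ` by ★ `archEigenlineProjector_eq_vecMulVec_of_conj_eq`, which is regularity-free).
* §3 at a RATIONAL pair under `hχ`: `σ_w(χ_g(u)) ≠ 0` (`evalC_eval_archCharpolyTwo_rationalArch_ne_zero`); the global projector `P = γ² − tr g·γ + det g·1 ≠ 0`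
  (`globalProjector_ne_zero_of_eval_ne_zero`: `σ_w(P) = v·qᵀ` with `v` a column of an invertible matrix and `q = σ_w(χ_g(u))`·(a row of one)); all the
  `κ`'s are Hilbert symbols of ONE global `x ∈ (L⁺)ˣ` (`exists_kappa_eq_hilbertSymbol_of_eval_ne_zero`; `x ≠ 0` by ANISOTROPY `hanis` applied to the
  non-zero column of `P`, instead of ★'s `κ_w ≠ 0`).
HONEST LABEL: HC_CM is proved only modulo the printed citations until rung 0 closes; count-neutral brick toward the (κ-sign) conjunct of the letter S1′
`stub_tamagawaSingularMembers_exist` of `Cruxes/H413/Lines/F0_P3a_SingularEllipticTransferPaydown.lean` — no stub closes.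

## References
* [Rogawski1990] J. D. Rogawski, *Automorphic Representations of Unitary Groups in Three Variables*, Ann. of Math. Stud. 123 (1990), §8.2 Prop. 8.2.1 (b)
  proof p. 117; §4.9 p. 55; §14.6 p. 242; §3.5 Prop. 3.5.2 (c) p. 29.
* [LanglandsShelstad1987] R. P. Langlands, D. Shelstad, *On the definition of transfer factors*, Math. Ann. 278 (1987), §2, §6.3–§6.4.
-/


set_option autoImplicit false

noncomputable section

open NumberField NumberField.InfinitePlace NumberField.mixedEmbedding IsDedekindDomain Filter Matrix
open Literature.NumberTheory.GaloisRepresentations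
open Literature.AlgebraicGeometry.ShimuraVarieties (hermForm)
open scoped Classical ComplexOrder MatrixGroups

namespace Literature.NumberTheory.Rogawski1990

open Literature.NumberTheory.Automorphic

variable (L : Type) [Field L] [NumberField L]

/-! ## §1 Rank-one algebra over `ℂ` (private plumbing, as in ★ `ExplicitFactorProductFormulaParts` §4) -/

section KappaAlgebra

variable {n : Type*} [Fintype n]

/-- `Σ_i |r_i|²` as the complex number `r̄ · r`. [folklore] -/
private theorem star_dotProduct_self_eq_ofReal' (r : n → ℂ) :
    star r ⬝ᵥ r = ((∑ i, Complex.normSq (r i) : ℝ) : ℂ) := by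
  rw [Complex.ofReal_sum]
  simp only [dotProduct, Pi.star_apply, Complex.star_def, Complex.normSq_eq_conj_mul_self]

/-- `Σ |r_i|² = 0 ↔ r = 0`. [folklore] -/
private theorem sum_normSq_eq_zero_iff' (r : n → ℂ) : (∑ i, Complex.normSq (r i)) = 0 ↔ r = 0 := by
  rw [← Complex.ofReal_eq_zero, ← star_dotProduct_self_eq_ofReal', dotProduct_star_self_eq_zero]

/-- Trace of a rank-one hermitian congruence: `tr((p qᵀ)ᴴ H (p qᵀ)) = (q̄·q)(p̄ᵀ H p)`. [folklore] -/
private theorem trace_conjTranspose_vecMulVec_mul_mul' (p q : n → ℂ) (H : Matrix n n ℂ) :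
    ((vecMulVec p q)ᴴ * H * vecMulVec p q).trace = (star q ⬝ᵥ q) * (star p ⬝ᵥ H *ᵥ p) := by
  rw [conjTranspose_vecMulVec, vecMulVec_mul, vecMulVec_mul_vecMulVec, trace_vecMulVec, dotProduct_smul, ← dotProduct_mulVec,
    smul_eq_mul, mul_comm]

/-- The `H`-value of the `j`-th column of a rank-one matrix: `(p q_j)ᴴ H (p q_j) = |q_j|² (p̄ᵀ H p)`. [folklore] -/
private theorem star_col_vecMulVec_dotProduct_mulVec' (p q : n → ℂ) (H : Matrix n n ℂ) (j : n) :
    star (fun i => vecMulVec p q i j) ⬝ᵥ H *ᵥ (fun i => vecMulVec p q i j) =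
      ((Complex.normSq (q j) : ℝ) : ℂ) * (star p ⬝ᵥ H *ᵥ p) := by
  have hcol : (fun i => vecMulVec p q i j) = q j • p := by
    funext i
    simp only [vecMulVec_apply, Pi.smul_apply, smul_eq_mul, mul_comm]
  rw [hcol, star_smul, mulVec_smul, dotProduct_smul, smul_dotProduct, smul_smul, smul_eq_mul, Complex.star_def,
    Complex.normSq_eq_conj_mul_self, mul_comm (q j)]

/-- `sign (r · z).re = sign z.re` for a real `r > 0`. [folklore] -/
private theorem sign_re_ofReal_mul' {r : ℝ} (hr : 0 < r) (z : ℂ) :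
    SignType.sign (((r : ℂ) * z).re) = SignType.sign z.re := by
  rw [Complex.re_ofReal_mul, sign_mul, sign_pos hr, one_mul]

end KappaAlgebra

/-! ## §2 `κ‴_w` as the sign of the `H′`-value of a column of `P` — without `G`-regularity -/

section KappaArch

variable [IsCMField L] (H' : Matrix (Fin 3) (Fin 3) L)
  (a : ↥(UnitaryGroup.arch (↥(maximalRealSubfield L)) L (IsCMField.complexConj L) 2
      (Matrix.of fun i j : Fin 2 => if i.val + j.val + 1 = 2 then (1 : L) else 0)) ×
    ↥(UnitaryGroup.arch (↥(maximalRealSubfield L)) L (IsCMField.complexConj L) 1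
      (Matrix.of fun i j : Fin 1 => if i.val + j.val + 1 = 1 then (1 : L) else 0)))
  (b : ↥(UnitaryGroup.arch (↥(maximalRealSubfield L)) L (IsCMField.complexConj L) 3 H'))
  (w : {w : InfinitePlace L // IsComplex w})

/-- **`κ‴_w(γ_H, γ′) = sgn Re σ_w(x_{j₀})` on ANY matching pair** — ★ `archKappaSignAt_eq_sign_re_embedding_columnFormValue` with its `G`-regularity (and
`hanis`, `hherm`) hypotheses REMOVED: if `P_w(γ_H, γ′) = σ_w(P)` for a matrix `P ∈ M₃(L)` and the column `j₀` of `P` is not zero, then `κ‴_w` — `sgn Re tr(P_wᴴ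
w(H′) P_w)` — equals `sgn Re σ_w(x_{j₀})`, `x_{j₀} = Σ c(P_{i j₀}) H′_{ik} P_{k j₀}`: `P_w = v qᵀ` has rank one (★ `archEigenlineProjector_eq_vecMulVec_of_conj_eq`,
regularity-free), so `tr(P_wᴴ H P_w) = ‖q‖²·vᴴHv` and `σ_w(x_{j₀}) = |q_{j₀}|²·vᴴHv` with `q_{j₀} ≠ 0`, and both signs are `sgn Re vᴴHv`.
[cite: Rogawski1990, §14.6 p. 242; §3.5 Prop. 3.5.2 (c) p. 29] [cite: LanglandsShelstad1987, §2] -/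
theorem archKappaSignAt_eq_sign_re_embedding_columnFormValue' (hp : IsArchNormPair L H' a b)
    {P : Matrix (Fin 3) (Fin 3) L} (hP : archEigenlineProjector L H' a w b = P.map w.1.embedding) {j₀ : Fin 3} (hj₀ : ∃ i, P i j₀ ≠ 0) :
    archKappaSignAt L H' a w b =
      (SignType.sign ((w.1.embedding (∑ i : Fin 3, ∑ k : Fin 3, IsCMField.complexConj L (P i j₀) * H' i k * P k j₀)).re) : ℤ) := by
  have hp' := hp
  rw [isArchNormPair_iff] at hp'
  obtain ⟨c, hc⟩ := isConj_iff.1 hp'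
  set φ := UnitaryGroup.evalC L w with hφ
  set H := H'.map w.1.embedding with hH
  set v : Fin 3 → ℂ := fun i => φ ((c : Matrix (Fin 3) (Fin 3) (mixedEmbedding.mixedSpace L)) i 1) with hv
  set s : ℂ := φ ((archCharpolyTwo L a).eval (archGammaTwo L a)) with hsdef
  set q : Fin 3 → ℂ := fun j => s * φ (((c⁻¹ : GL (Fin 3) (mixedEmbedding.mixedSpace L)) : Matrix (Fin 3) (Fin 3) (mixedEmbedding.mixedSpace L)) 1 j)
    with hq
  have hPvq : archEigenlineProjector L H' a w b = vecMulVec v q := archEigenlineProjector_eq_vecMulVec_of_conj_eq L H' a b w c hc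
  have hPw : P.map w.1.embedding = vecMulVec v q := hP.symm.trans hPvq
  -- `q_{j₀} ≠ 0`: column `j₀` of `P_w = v qᵀ` is `q_{j₀} • v`, and it is non-zero because column `j₀` of `P` is
  have hq0 : q j₀ ≠ 0 := by
    obtain ⟨i, hi⟩ := hj₀
    have h1 : (P.map w.1.embedding) i j₀ ≠ 0 := by
      rw [Matrix.map_apply]
      exact (map_ne_zero w.1.embedding).2 hi
    rw [hPw, vecMulVec_apply] at h1
    exact right_ne_zero_of_mul h1
  have hqq : q ≠ 0 := fun h => hq0 (by rw [h, Pi.zero_apply])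
  have hQ : 0 < ∑ i, Complex.normSq (q i) :=
    lt_of_le_of_ne (Finset.sum_nonneg fun i _ => Complex.normSq_nonneg _) (fun h => hqq ((sum_normSq_eq_zero_iff' q).1 h.symm))
  have hQ0 : 0 < Complex.normSq (q j₀) := Complex.normSq_pos.2 hq0
  -- both sides are `sign (vᴴ H v).re`
  unfold archKappaSignAt
  rw [hPvq, trace_conjTranspose_vecMulVec_mul_mul', star_dotProduct_self_eq_ofReal', sign_re_ofReal_mul' hQ,
    embedding_columnFormValue L H' w P j₀, hPw, star_col_vecMulVec_dotProduct_mulVec', sign_re_ofReal_mul' hQ0]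

end KappaArch

/-! ## §3 A rational pair under `χ_g(u) ≠ 0`: `σ_w(χ_g(u)) ≠ 0`, `P ≠ 0`, and all `κ`'s are Hilbert symbols of one global element -/

section KappaPair

variable [IsCMField L] (H' : Matrix (Fin 3) (Fin 3) L)
  (γH : (UnitaryGroup.cmDatum L 2 (Matrix.of fun i j : Fin 2 => if i.val + j.val + 1 = 2 then (1 : L) else 0)).Rational ×
      (UnitaryGroup.cmDatum L 1 (Matrix.of fun i j : Fin 1 => if i.val + j.val + 1 = 1 then (1 : L) else 0)).Rational)
  (γ : (UnitaryGroup.cmDatum L 3 H').Rational)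

/-- **`σ_w(χ_g(u)) ≠ 0` at every complex place** from the GLOBAL `χ_g(u) ≠ 0` (★ `archCharpolyTwo_rationalArch`, ★ `archGammaTwo_rationalArch`,
injectivity of `σ_w`). [cite: Rogawski1990, §4.9 p. 55] -/
theorem evalC_eval_archCharpolyTwo_rationalArch_ne_zero
    (hχ : ((γH.1.val.val : Matrix (Fin 2) (Fin 2) L).charpoly).eval ((γH.2.val.val : Matrix (Fin 1) (Fin 1) L) 0 0) ≠ 0)
    (w : {w : InfinitePlace L // IsComplex w}) :
    UnitaryGroup.evalC L w ((archCharpolyTwo L (rationalArch L γH)).eval (archGammaTwo L (rationalArch L γH))) ≠ 0 := by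
  rw [archCharpolyTwo_rationalArch, archGammaTwo_rationalArch, Polynomial.eval_map, Polynomial.eval₂_hom, UnitaryGroup.evalC_apply,
    mixedEmbedding_apply_isComplex]
  exact (map_ne_zero _).2 hχ

/-- **The global projector `P = γ² − tr g·γ + det g·1` of a rational matching pair with `χ_g(u) ≠ 0` is non-zero** — at any complex place `σ_w(P) = v·qᵀ`
(★ `archEigenlineProjector_eq_vecMulVec_of_conj_eq`, ★ `archEigenlineProjector_rationalArch`) with `v` the middle column of an invertible `c_w` and `q =
σ_w(χ_g(u))`·(the middle row of `c_w⁻¹`), both non-zero. [cite: Rogawski1990, §14.6 p. 242; §4.9 p. 55] -/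
theorem globalProjector_ne_zero_of_eval_ne_zero
    (hχ : ((γH.1.val.val : Matrix (Fin 2) (Fin 2) L).charpoly).eval ((γH.2.val.val : Matrix (Fin 1) (Fin 1) L) 0 0) ≠ 0)
    (hγ : IsNormPair L H' γH γ) :
    ((γ.val.val : Matrix (Fin 3) (Fin 3) L) * γ.val.val - (γH.1.val.val : Matrix (Fin 2) (Fin 2) L).trace • (γ.val.val : Matrix (Fin 3) (Fin 3) L) +
        (γH.1.val.val : Matrix (Fin 2) (Fin 2) L).det • (1 : Matrix (Fin 3) (Fin 3) L)) ≠ 0 := by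
  intro hP
  obtain ⟨w⟩ : Nonempty (InfinitePlace L) := inferInstance
  let wc : {w : InfinitePlace L // IsComplex w} := ⟨w, IsTotallyComplex.isComplex w⟩
  have hparch := isArchNormPair_rationalArch_cmRationalToArch hγ
  have hp' := hparch
  rw [isArchNormPair_iff] at hp'
  obtain ⟨c, hc⟩ := isConj_iff.1 hp'
  set φ := UnitaryGroup.evalC L wc with hφ
  set v : Fin 3 → ℂ := fun i => φ ((c : Matrix (Fin 3) (Fin 3) (mixedEmbedding.mixedSpace L)) i 1) with hv
  set s : ℂ := φ ((archCharpolyTwo L (rationalArch L γH)).eval (archGammaTwo L (rationalArch L γH))) with hsdef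
  set q : Fin 3 → ℂ := fun j => s * φ (((c⁻¹ : GL (Fin 3) (mixedEmbedding.mixedSpace L)) : Matrix (Fin 3) (Fin 3) (mixedEmbedding.mixedSpace L)) 1 j)
    with hq
  have hPvq : archEigenlineProjector L H' (rationalArch L γH) wc (cmRationalToArch L 3 H' γ) = vecMulVec v q :=
    archEigenlineProjector_eq_vecMulVec_of_conj_eq L H' (rationalArch L γH) (cmRationalToArch L 3 H' γ) wc c hc
  have hs : s ≠ 0 := evalC_eval_archCharpolyTwo_rationalArch_ne_zero L γH hχ wc
  -- `c_w`, `c_w⁻¹`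
  set cw := (c : Matrix (Fin 3) (Fin 3) (mixedEmbedding.mixedSpace L)).map φ with hcw
  set cw' := ((c⁻¹ : GL (Fin 3) (mixedEmbedding.mixedSpace L)) : Matrix (Fin 3) (Fin 3) (mixedEmbedding.mixedSpace L)).map φ with hcw'
  have h1 : cw' * cw = 1 := by
    rw [hcw, hcw', ← Matrix.map_mul, ← Units.val_mul, inv_mul_cancel, Units.val_one, Matrix.map_one _ (map_zero φ) (map_one φ)]
  have h2 : cw * cw' = 1 := by
    rw [hcw, hcw', ← Matrix.map_mul, ← Units.val_mul, mul_inv_cancel, Units.val_one, Matrix.map_one _ (map_zero φ) (map_one φ)]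
  -- `P_w = 0`
  have hPw0 : vecMulVec v q = 0 := by
    rw [← hPvq, archEigenlineProjector_rationalArch L H' γH wc γ, hP, Matrix.map_zero _ (map_zero _)]
  -- `v ≠ 0` (a column of the invertible `c_w`)
  have hv0 : v ≠ 0 := by
    intro hv0
    have h11 := congrFun (congrFun h1 1) 1
    rw [Matrix.mul_apply, Matrix.one_apply_eq] at h11
    have hcol : ∀ j, cw j 1 = 0 := fun j => by
      have := congrFun hv0 j
      simpa [hv, hcw] using this
    simp [hcol] at h11
  -- `q ≠ 0` (a non-zero multiple of a row of the invertible `c_w⁻¹`)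
  have hq0 : q ≠ 0 := by
    intro hq0
    have h11 := congrFun (congrFun h1 1) 1
    rw [Matrix.mul_apply, Matrix.one_apply_eq] at h11
    have hrow : ∀ j, cw' 1 j = 0 := fun j => by
      have hj : s * φ (((c⁻¹ : GL (Fin 3) (mixedEmbedding.mixedSpace L)) : Matrix (Fin 3) (Fin 3) (mixedEmbedding.mixedSpace L)) 1 j) = 0 :=
        congrFun hq0 j
      rcases mul_eq_zero.1 hj with h | h
      · exact absurd h hs
      · simpa [hcw'] using h
    simp [hrow] at h11
  -- a rank-one product of non-zero vectors is non-zero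
  obtain ⟨i, hi⟩ := Function.ne_iff.1 hv0
  obtain ⟨j, hj⟩ := Function.ne_iff.1 hq0
  have hij := congrFun (congrFun hPw0 i) j
  rw [vecMulVec_apply, Matrix.zero_apply] at hij
  exact (mul_ne_zero hi hj) hij

/-- **ALL THE `κ`'S OF A RATIONAL `(G,H)`-REGULAR PAIR ARE HILBERT SYMBOLS OF ONE GLOBAL ELEMENT** — ★ `exists_kappa_eq_hilbertSymbol` with `IsGRegular`
weakened to `χ_g(u) ≠ 0`: there is `x ∈ (L⁺)ˣ` — the `H′`-value `p_{j₀}ᴴ H′ p_{j₀}` of the first non-zero column of the global projector `P` — with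
`κ_v((γ_H)_v, γ_v) = (x, θ)_v` at every finite place (★ `finKappaAt_rationalComponent`, regularity-free) and `κ‴_w(γ_H ⊗ 1, γ ⊗ 1) = (x, θ)_{w|L⁺}` at every
complex place (§2); `x ≠ 0` because `H′` is ANISOTROPIC on `L³` (`hanis`) and the column is not zero.  `θ` = ★ `cmQuadraticGenerator L`.
[cite: Rogawski1990, §14.6 p. 242; §3.5 Prop. 3.5.2 (c) p. 29] [cite: LanglandsShelstad1987, §6.3–6.4] -/
theorem exists_kappa_eq_hilbertSymbol_of_eval_ne_zero (hherm : (H'.map (cmConjRingHom L)).transpose = H')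
    (hanis : ∀ x : Fin 3 → L, hermForm (cmConjRingHom L) H' x x = 0 → x = 0)
    (hχ : ((γH.1.val.val : Matrix (Fin 2) (Fin 2) L).charpoly).eval ((γH.2.val.val : Matrix (Fin 1) (Fin 1) L) 0 0) ≠ 0)
    (hγ : IsNormPair L H' γH γ) :
    ∃ x : ↥(maximalRealSubfield L), x ≠ 0 ∧
      (∀ v : HeightOneSpectrum (𝓞 ↥(maximalRealSubfield L)),
        finKappaAt L v H' (rationalComponent L γH v) ((UnitaryGroup.cmDatum L 3 H').toLocal v ((UnitaryGroup.cmDatum L 3 H').toAdelic γ)) =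
          QuadraticForms.hilbertSymbol (v.adicCompletion ↥(maximalRealSubfield L)) (x : v.adicCompletion ↥(maximalRealSubfield L))
            ((cmQuadraticGenerator L : ↥(maximalRealSubfield L)) : v.adicCompletion ↥(maximalRealSubfield L))) ∧
      (∀ w : {w : InfinitePlace L // IsComplex w},
        archKappaSignAt L H' (rationalArch L γH) w (cmRationalToArch L 3 H' γ) =
          QuadraticForms.hilbertSymbol (IsCMField.equivInfinitePlace L w.1).Completion
            (algebraMap ↥(maximalRealSubfield L) _ x) (algebraMap ↥(maximalRealSubfield L) _ (cmQuadraticGenerator L : ↥(maximalRealSubfield L)))) := by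
  -- the global projector, its first non-zero column, the global relative position `x₀ ∈ L` and its descent `x ∈ L⁺`
  set P : Matrix (Fin 3) (Fin 3) L := (γ.val.val : Matrix (Fin 3) (Fin 3) L) * γ.val.val -
      (γH.1.val.val : Matrix (Fin 2) (Fin 2) L).trace • (γ.val.val : Matrix (Fin 3) (Fin 3) L) +
        (γH.1.val.val : Matrix (Fin 2) (Fin 2) L).det • (1 : Matrix (Fin 3) (Fin 3) L) with hPdef
  have hP0 : P ≠ 0 := globalProjector_ne_zero_of_eval_ne_zero L H' γH γ hχ hγ
  have h : ∃ j : Fin 3, ∃ i : Fin 3, P i j ≠ 0 := by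
    by_contra hcon
    refine hP0 (Matrix.ext fun i j => ?_)
    by_contra hne
    exact hcon ⟨j, i, hne⟩
  set j₀ : Fin 3 := Fin.find (fun j : Fin 3 => ∃ i : Fin 3, P i j ≠ 0) h with hj₀def
  have hj₀ : ∃ i : Fin 3, P i j₀ ≠ 0 := Fin.find_spec h
  set x₀ : L := ∑ i : Fin 3, ∑ k : Fin 3, IsCMField.complexConj L (P i j₀) * H' i k * P k j₀ with hx₀def
  have hx₀c : IsCMField.complexConj L x₀ = x₀ := complexConj_columnFormValue L H' hherm P j₀
  have hx₀mem : x₀ ∈ maximalRealSubfield L := (IsCMField.complexConj_eq_self_iff L x₀).1 hx₀c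
  set x : ↥(maximalRealSubfield L) := ⟨x₀, hx₀mem⟩ with hxdef
  have hxx₀ : algebraMap ↥(maximalRealSubfield L) L x = x₀ := rfl
  -- `x₀ ≠ 0` by anisotropy: `x₀ = hermForm c H′ p p` for the non-zero column `p = P_{· j₀}`
  have hx₀0 : x₀ ≠ 0 := by
    intro h0
    obtain ⟨i, hi⟩ := hj₀
    have hform : hermForm (cmConjRingHom L) H' (fun k => P k j₀) (fun k => P k j₀) = x₀ := by
      unfold hermForm
      rw [hx₀def]
      simp only [dotProduct, mulVec, Function.comp_apply, cmConjRingHom_apply, Finset.mul_sum, mul_assoc]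
    have hp0 := hanis (fun k => P k j₀) (hform.trans h0)
    exact hi (congrFun hp0 i)
  have hx0 : x ≠ 0 := fun hx => hx₀0 (by rw [← hxx₀, hx, map_zero])
  -- arch data
  have hparch := isArchNormPair_rationalArch_cmRationalToArch hγ
  have harch : ∀ w : {w : InfinitePlace L // IsComplex w},
      archKappaSignAt L H' (rationalArch L γH) w (cmRationalToArch L 3 H' γ) = (SignType.sign ((w.1.embedding x₀).re) : ℤ) := fun w =>
    archKappaSignAt_eq_sign_re_embedding_columnFormValue' L H' (rationalArch L γH) (cmRationalToArch L 3 H' γ) w hparch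
      (archEigenlineProjector_rationalArch L H' γH w γ) hj₀
  -- the CM generator
  obtain ⟨α, hα0, hαc, hαsq⟩ := cmQuadraticGenerator_spec L
  have hαα : α * α = algebraMap ↥(maximalRealSubfield L) L (cmQuadraticGenerator L : ↥(maximalRealSubfield L)) := by rw [← sq]; exact hαsq
  refine ⟨x, hx0, fun v => ?_, fun w => ?_⟩
  · -- finite place
    rw [finKappaAt_rationalComponent, if_neg hP0, dif_pos h]
    change (if ¬ Subsingleton (UnitaryGroup.PlacesOver L v) then (1 : ℤ)
      else if ∃ z : UnitaryGroup.LocalRing L v, IsUnit z ∧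
          algebraMap L (UnitaryGroup.LocalRing L v) (algebraMap ↥(maximalRealSubfield L) L x) =
            z * UnitaryGroup.conjLocal L (IsCMField.complexConj L) v z then 1 else -1) = _
    exact UnitaryGroup.ite_normTest_algebraMap_eq_hilbertSymbol L (IsCMField.complexConj L) hαc hα0 hαα
      (IsCMField.complexConj_ne_one L) v hx0
  · -- complex place
    rw [harch w, hilbertSymbol_equivInfinitePlace_eq_sign L w.1 hx0, hxx₀]

end KappaPair

end Literature.NumberTheory.Rogawski1990
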